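import Summits.ResolutionOfSingularities.ResolutionOfSingularities.Theorems.FrobeniusLadderFInjectiveMacaulayficationOfFullBlowupGe4
import Summits.ResolutionOfSingularities.ResolutionOfSingularities.Theorems.FrobeniusLadderFInjectiveMacaulayficationFTemkinClosedPointsGen
import Summits.ResolutionOfSingularities.ResolutionOfSingularities.Theorems.FrobeniusLadderFInjectiveMacaulayficationRegularOffFiniteOfLR
import Summits.ResolutionOfSingularities.ResolutionOfSingularities.Theorems.FrobeniusLadderFInjectiveMacaulayficationLocalFullificationFibreGe4
import HarnessLib

/-!
# (E6) THE LOCAL DOOR: the crux `FInjectiveMacaulayfication` from {CP 2019 Thm. 1.1, Raynaud–Gruson, CP 2019 Prop. 4.4} ∧ (LR) ∧ (LF)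
# (crux stmt-ResolutionOfSingularities-15315, chain w45a; res-L1-w45a-plan-1 RULING R17.4 «LD» (E6); seat res-L1-w45a-stub-1 g7)

[OURS · L1 W4.5a] Support file (`--supports stmt-ResolutionOfSingularities-15315 --as helper`); replaces the role of NO printed item; NOT a statement of the
manuscript; def-free; THEOREMS modulo three printed results BY NAME (`CossartPiltant2019General`, `Stacks081R`, `CossartPiltant2019Principalization`) and the
chain's two d-UNIFORM LOCAL CANDIDATE statements, consumed as hypotheses: (LR) `RegularOffFiniteOfLR.LocalResolutionNonClosedGe4` (res-L1-w45a-stub-3: local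
RESOLUTION of blow-ups of `Spec 𝒪_{X,x}` at NON-closed `x` of local dimension `≥ 4`) and (LF) `LocalFullificationFibreGe4.LocalFullificationFibreGe4`
(res-L1-w45a-stub-2: fibre-supported local FULL-ification in every local dimension `d ≥ 4`). AI-written (AI review is weaker than expert review).

* `fiModel_integral_of_localDoor (hG h081R hP hLR hLF)`: every integral separated finite-type `X/k` has a proper birational INTEGRAL model all of whose
  stalks are FULL — dimension `≤ 3` by Cossart–Piltant outright, dimension `≥ 4` by res-L1-w45a-stub-2's generalised F-Temkin engine
  `FTemkinClosedPointsGen.exists_isBlowup_full_of_LFfibre` (THEOREM A-gen over (LR), then (LF) at the closed points of the top dimension), through the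
  glue `OfFullBlowupGe4.fiModel_integral_of_fullBlowupGe4` (THEOREM A-gen `RegularOffFiniteOfLR.regularOffFinite_of_LR` feeds
  `FTemkinClosedPointsGen.exists_isBlowup_full_of_LF_of_regularOffFinite`).
* `fInjectiveMacaulayfication_text_of_localDoor` — the crux's ∀-text VERBATIM (reduced `X`: integral components); and
  **`fInjectiveMacaulayfication_of_localDoor (hG h081R hP hLR hLF) : Theses.FrobeniusLadder.FInjectiveMacaulayfication`** — the route decl itself, the
  `_proof` term of door v36 «LocalDoor» (res-L1-w45a-lead-1 (E7)).
[folklore assembly; cite: CossartPiltant2019, Thm. 1.1 (i)(ii); Prop. 4.4] [cite: RaynaudGruson1971, Thm. 5.2.2] [cite: Temkin2008, Prop. 2.3.4; Lemma 2.1.1]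
-/

-- single-problem summit: the doubled namespace component is forced
set_option linter.dupNamespace false

noncomputable section

namespace Summit.ResolutionOfSingularities.ResolutionOfSingularities.Theorems.FInjectiveMacaulayfication.OfLocalDoor

open CategoryTheory CategoryTheory.Limits AlgebraicGeometry TopologicalSpace IsLocalRing
open Literature.AlgebraicGeometry.Resolution
open Summit.ResolutionOfSingularities.ResolutionOfSingularities.Theorems.FInjectiveMacaulayfication
open SliceableCentre

/-- The local door supplies the FULL blow-up model in dimension `≥ 4` (the input shape of `OfFullBlowupGe4`). [OURS · conditional-result]
[cite: Temkin2008, Prop. 2.3.4] [cite: CossartPiltant2019, Thm. 1.1 (i)(ii); Prop. 4.4] -/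
theorem fullBlowupGe4_of_localDoor
    (hG : CossartPiltant2019General.{0}) (h081R : Stacks081R.{0}) (hP : CossartPiltant2019Principalization.{0})
    (hLR : RegularOffFiniteOfLR.LocalResolutionNonClosedGe4) (hLF : LocalFullificationFibreGe4.LocalFullificationFibreGe4)
    (p : ℕ) (hp : p.Prime) :
    ∀ (k : Type) [Field k] [CharP k p] (X : Scheme.{0}) (f : X ⟶ Spec (.of k)),
      IsSeparated f → LocallyOfFiniteType f → QuasiCompact f → IsIntegral X → (4 : WithBot ℕ∞) ≤ topologicalKrullDim X →
      ∃ (X'' : Scheme.{0}) (f'' : X'' ⟶ X) (J'' : X.IdealSheafData), IsBlowup f'' J'' ∧ J'' ≠ ⊥ ∧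
        ∀ x'' : X'', FullCl p (X''.presheaf.stalk x'') := by
  intro k _ _ X f hs hl hq hi hd
  haveI := hs
  haveI := hl
  haveI := hq
  haveI := hi
  have h3 : (3 : WithBot ℕ∞) ≤ topologicalKrullDim X := le_trans (by norm_num) hd
  obtain ⟨X'', f'', J'', hf'', hJ'', -, hfull⟩ :=
    FTemkinClosedPointsGen.exists_isBlowup_full_of_LF_of_regularOffFinite (fun d h => hLF d h) p hp k X f hd
      (RegularOffFiniteOfLR.regularOffFinite_of_LR hG h081R hP hLR p hp k X f h3)
  exact ⟨X'', f'', J'', hf'', hJ'', hfull⟩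

/-- **The crux's INTEGRAL FORM from the local door.** [OURS · conditional-result]
[cite: CossartPiltant2019, Thm. 1.1 (i)(ii); Prop. 4.4] [cite: Temkin2008, Prop. 2.3.4] -/
theorem fiModel_integral_of_localDoor
    (hG : CossartPiltant2019General.{0}) (h081R : Stacks081R.{0}) (hP : CossartPiltant2019Principalization.{0})
    (hLR : RegularOffFiniteOfLR.LocalResolutionNonClosedGe4) (hLF : LocalFullificationFibreGe4.LocalFullificationFibreGe4)
    (p : ℕ) [hp : Fact p.Prime] (k : Type) [Field k] [CharP k p] (X : Scheme.{0}) (f : X ⟶ Spec (.of k))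
    [IsSeparated f] [LocallyOfFiniteType f] [QuasiCompact f] [IsIntegral X] :
    ∃ (X' : Scheme.{0}) (π : X' ⟶ X), IsProper π ∧ IsBirational π ∧ IsIntegral X' ∧ ∀ x : X', FullCl p (X'.presheaf.stalk x) :=
  OfFullBlowupGe4.fiModel_integral_of_fullBlowupGe4 hG p (fullBlowupGe4_of_localDoor hG h081R hP hLR hLF p hp.out) k X f

/-- **★ THE CRUX'S ∀-TEXT VERBATIM from the local door.** [OURS · conditional-result]
[cite: CossartPiltant2019, Thm. 1.1 (i)(ii); Prop. 4.4] [cite: Temkin2008, Prop. 2.3.4] -/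
theorem fInjectiveMacaulayfication_text_of_localDoor
    (hG : CossartPiltant2019General.{0}) (h081R : Stacks081R.{0}) (hP : CossartPiltant2019Principalization.{0})
    (hLR : RegularOffFiniteOfLR.LocalResolutionNonClosedGe4) (hLF : LocalFullificationFibreGe4.LocalFullificationFibreGe4) :
    ∀ p : ℕ, p.Prime → ∀ (k : Type) [Field k] [CharP k p] (X : Scheme.{0}) (f : X ⟶ Spec (.of k)),
      IsSeparated f → LocallyOfFiniteType f → QuasiCompact f → IsReduced X →
      ∃ (X' : Scheme.{0}) (π : X' ⟶ X), IsProper π ∧ IsBirational π ∧ ∀ x : X',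
        IsDomain (X'.presheaf.stalk x) ∧ ∀ d : ℕ, ringKrullDim (X'.presheaf.stalk x) = d →
          ∀ s : Fin d → X'.presheaf.stalk x, (Ideal.span (Set.range s)).radical.IsMaximal →
            RingTheory.Sequence.IsWeaklyRegular (X'.presheaf.stalk x) (List.ofFn s) ∧
            ∀ y : X'.presheaf.stalk x, (∃ e : ℕ, y ^ p ^ e ∈ Ideal.span
              ((fun z : X'.presheaf.stalk x => z ^ p ^ e) ''
                (Ideal.span (Set.range s) : Set (X'.presheaf.stalk x)))) →
              y ∈ Ideal.span (Set.range s) :=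
  OfFullBlowupGe4.fInjectiveMacaulayfication_text_of_fullBlowupGe4 hG
    (fun p hp => fullBlowupGe4_of_localDoor hG h081R hP hLR hLF p hp)

/-- **★★ THE ROUTE DECL `Theses.FrobeniusLadder.FInjectiveMacaulayfication` FROM THE LOCAL DOOR** {CP 1.1, 081R, CP 4.4} ∧ (LR) ∧ (LF) — door v36's
`_proof` term. [OURS · conditional-result] [cite: CossartPiltant2019, Thm. 1.1 (i)(ii); Prop. 4.4] [cite: Temkin2008, Prop. 2.3.4] -/
theorem fInjectiveMacaulayfication_of_localDoor
    (hG : CossartPiltant2019General.{0}) (h081R : Stacks081R.{0}) (hP : CossartPiltant2019Principalization.{0})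
    (hLR : RegularOffFiniteOfLR.LocalResolutionNonClosedGe4) (hLF : LocalFullificationFibreGe4.LocalFullificationFibreGe4) :
    Summit.ResolutionOfSingularities.ResolutionOfSingularities.Theses.FrobeniusLadder.FInjectiveMacaulayfication :=
  OfFullBlowupGe4.fInjectiveMacaulayfication_of_fullBlowupGe4 hG (fun p hp => fullBlowupGe4_of_localDoor hG h081R hP hLR hLF p hp)

end Summit.ResolutionOfSingularities.ResolutionOfSingularities.Theorems.FInjectiveMacaulayfication.OfLocalDoor

end
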